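import Mathlib
import Summits.NavierStokesRegularity.NavierStokesRegularity.Theorems.EulerZoomLiouvillePowerGaugeEulerLiouvilleBirthDefs
import HarnessLib

/-!
# Crux `EulerZoomLiouville.PowerGaugeEulerLiouville` (stmt-NavierStokesRegularity-19832): the binder predicates of the
# LEAD skeleton, part 2 of 3 (`IsTameC2Profile` … `IsBernoulliClockedCore`)

Continuation of `…BirthDefs` (same namespace `…Theorems.PowerGaugeEulerLiouville.Birth`): lines 403–627 of the LEAD skeleton
`Cruxes/PowerGaugeEulerLiouville/Lines/birth.lean` v115 (commit 97807a79e132), VERBATIM.  Credits / senses: the LEAD's `CENSUS-19832-vNN.md`.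

WHAT THIS IS NOT: not NS, not E — DEFINITIONS ONLY; the crux 19832 stays OPEN.
-/

noncomputable section

open MeasureTheory Set Filter Topology Metric
open scoped ENNReal NNReal ContDiff

-- flat `Theorems/<Route><Decl>…` files of one crux share the namespace of the crux (tree convention)
set_option linter.dupNamespace false

namespace Summit.NavierStokesRegularity.NavierStokesRegularity.Theorems.PowerGaugeEulerLiouville.Birth

/-- TAME `C²` velocity profile (v43/v48; credits: CENSUS files): `V ∈ C²` and EITHER UNIFORMLY CONTINUOUS (⊇ bounded gradient) OR WITH BERNOULLI PIERCING (`HasBernoulliPiercing`;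
⊇ irrotational piercing ⊇ radial barrier ⊇ sub-drift ⊇ bounded ⊇ compact vorticity); Loc and past fillers by name. -/
@[reducible] def IsTameC2Profile (ρ : ℝ) (V : E3 → E3) : Prop :=
  ContDiff ℝ 2 V ∧ (UniformContinuous V ∨ HasBernoulliPiercing ρ V)

/-- The VELOCITY is EXACTLY SELF-SIMILAR ABOUT `(T, x₀)` ON THE PAST SUB-SLAB `τ < T₁` (v23; v58 velocity-only by past pressure slaving, ns-ezl-w3 g2 p635404
`PressureSlaving.inClass_pastSelfSimilarPressure`): `u(τ, x) = (T−τ)^{γ−1} V((T−τ)^{−γ}(x − x₀))` for `τ < T₁` only — arbitrary on `[T₁, 0)` (meaningful for `T₁ ≤ 0`, `T₁ ≤ T`).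
The `hu`-binder shape of `Past.selfSimilar_ae_eq_zero_of_…C2_profile`. -/
@[reducible] def IsPastSelfSimilar (ρ T T₁ : ℝ) (x₀ : E3) (u : ℝ → E3 → E3) (V : E3 → E3) : Prop :=
  ∀ τ : ℝ, τ < T₁ → u τ = fun x => Literature.Analysis.FluidPDE.selfSimilarCollapse (1 / (2 + ρ)) T V τ (x - x₀)

/-- PAST-EXACTLY SELF-SIMILAR about some `(T, x₀)` for `τ < T₁` (`T₁ ≤ 0`, `T₁ ≤ T`; velocity-only, past pressure slaving p635404) with a profile in one of the killed classes — senses/credits: CENSUS-19832-vNN.md. -/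
@[reducible] def IsPastSelfSimilarClassical (ρ : ℝ) (u : ℝ → E3 → E3) : Prop :=
  (∃ (T T₁ : ℝ) (x₀ : E3) (V : E3 → E3),
      T₁ ≤ 0 ∧ T₁ ≤ T ∧ IsPastSelfSimilar ρ T T₁ x₀ u V ∧ IsTameC2Profile ρ V) ∨
    (∃ (T T₁ : ℝ) (x₀ : E3) (V : E3 → E3),
      T₁ ≤ 0 ∧ T₁ ≤ T ∧ IsPastSelfSimilar ρ T T₁ x₀ u V ∧ IsHomogeneousProfile ρ V) ∨
    (∃ (T T₁ : ℝ) (x₀ : E3) (V : E3 → E3),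
      T₁ ≤ 0 ∧ T₁ ≤ T ∧ IsPastSelfSimilar ρ T T₁ x₀ u V ∧ ContDiff ℝ 2 V ∧
      ((∀ P' : E3 → ℝ, Literature.Analysis.FluidPDE.IsSelfSimilarEulerProfile (1 / (2 + ρ)) 0 V P' →
        (∃ Mb : ℝ, ∀ y : E3, Literature.Analysis.FluidPDE.selfSimilarBernoulli (1 / (2 + ρ)) 0 V P' y ≤ Mb) ∧
        (∃ ε R₀ : ℝ, ε < (1 / (2 + ρ)) * (1 - 1 / (2 + ρ)) / 2 ∧ ∀ y : E3, R₀ ≤ ‖y‖ → P' y ≤ ε * ‖y‖ ^ 2)) ∨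
       ((∀ P' : E3 → ℝ, Literature.Analysis.FluidPDE.IsSelfSimilarEulerProfile (1 / (2 + ρ)) 0 V P' →
        ∃ Mb : ℝ, ∀ y : E3, Literature.Analysis.FluidPDE.curl V y ≠ 0 → Literature.Analysis.FluidPDE.selfSimilarBernoulli (1 / (2 + ρ)) 0 V P' y ≤ Mb) ∧
      (∃ A q R₀ : ℝ, 0 ≤ A ∧ 0 ≤ q ∧ q < 2 + 2 * (1 + 2 * ρ) / 3 ∧
        ∀ z : E3, R₀ ≤ ‖z‖ → Literature.Analysis.FluidPDE.frobeniusNormSq (fderiv ℝ V z) - ‖Literature.Analysis.FluidPDE.curl V z‖ ^ 2 ≤ A * ‖z‖ ^ q)))) ∨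
    (∃ (T T₁ : ℝ) (x₀ : E3) (V : E3 → E3),
      T₁ ≤ 0 ∧ T₁ ≤ T ∧ IsPastSelfSimilar ρ T T₁ x₀ u V ∧ ContDiff ℝ 2 V ∧ HasFastVorticalChannel ρ V) ∨
    (∃ (T T₁ : ℝ) (x₀ : E3) (V : E3 → E3),
      T₁ ≤ 0 ∧ T₁ ≤ T ∧ IsPastSelfSimilar ρ T T₁ x₀ u V ∧ ContDiff ℝ 2 V ∧
        ∃ R : E3 ≃ₗᵢ[ℝ] E3, Literature.Analysis.FluidPDE.IsAxisymmetric (fun y => R (V (R.symm y)))) ∨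
    (∃ (T T₁ : ℝ) (x₀ : E3) (V : E3 → E3),
      T₁ ≤ 0 ∧ T₁ ≤ T ∧ IsPastSelfSimilar ρ T T₁ x₀ u V ∧ ContDiff ℝ 2 V ∧ HasResidenceClock ρ V) ∨
    (∃ (T T₁ : ℝ) (x₀ : E3) (V : E3 → E3),
      T₁ ≤ 0 ∧ T₁ ≤ T ∧ IsPastSelfSimilar ρ T T₁ x₀ u V ∧ ContDiff ℝ 2 V ∧
      (∀ c' : ℝ, 0 < c' → ∀ R₀ : ℝ, ∃ R : ℝ, R₀ ≤ R ∧
        ∀ z ∈ Metric.ball (0 : E3) (3 * R), ‖fderiv ℝ V z‖ ≤ Real.exp (c' * R ^ (2 + ρ))))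

/-- PAST-EXACTLY SELF-SIMILAR WITH A SUB-EXTREMAL PROFILE — senses/credits: CENSUS-19832-vNN.md. -/
@[reducible] def IsPastSelfSimilarSubExtremal (ρ : ℝ) (u : ℝ → E3 → E3) : Prop :=
  (∃ (T T₁ : ℝ) (x₀ : E3) (V : E3 → E3),
    T₁ ≤ 0 ∧ T₁ ≤ T ∧ IsPastSelfSimilar ρ T T₁ x₀ u V ∧
      ∀ ε : ℝ, 0 < ε → ∀ L₀ : ℝ, ∃ L : ℝ, L₀ ≤ L ∧
        L ^ (2 * ρ - 1) * ∫ y in Metric.ball (0 : E3) L, ‖V y‖ ^ 2 < ε) ∨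
  (∃ (T T₁ : ℝ) (x₀ : E3) (V : E3 → E3) (q R₀ : ℝ),
    T₁ ≤ 0 ∧ T₁ ≤ T ∧ IsPastSelfSimilar ρ T T₁ x₀ u V ∧ ρ < 1 / 2 ∧ 2 ≤ q ∧ q ≤ 3 / (1 + ρ) ∧
      MemLp V (ENNReal.ofReal q) (volume.restrict {y : E3 | R₀ ≤ ‖y‖})) ∨
  (∃ (T T₁ : ℝ) (x₀ : E3) (V : E3 → E3) (G : E3 → E3 →L[ℝ] E3) (R₀ : ℝ),
    T₁ ≤ 0 ∧ T₁ ≤ T ∧ IsPastSelfSimilar ρ T T₁ x₀ u V ∧ ρ < 1 / 2 ∧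
      Literature.Analysis.FunctionSpaces.HasWeakFDerivOn (⊤ : TopologicalSpace.Opens E3) volume V G ∧
      ∀ᵐ y ∂(volume : Measure E3), R₀ < ‖y‖ → ∀ v w : E3, inner ℝ (G y v) w = inner ℝ (G y w) v) ∨
  (∃ (T T₁ : ℝ) (x₀ : E3) (V : E3 → E3) (R₀ : ℝ),
    T₁ ≤ 0 ∧ T₁ ≤ T ∧ IsPastSelfSimilar ρ T T₁ x₀ u V ∧ ρ < 1 / 2 ∧
      ∀ g : E3 → ℝ, Literature.Analysis.FunctionSpaces.IsTestFunctionOn (⊤ : TopologicalSpace.Opens E3) g →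
        tsupport g ⊆ {y : E3 | R₀ < ‖y‖} → ∀ a b : E3, ∫ x, inner ℝ (V x) (fderiv ℝ g x a • b - fderiv ℝ g x b • a) = 0) ∨
  (∃ (T T₁ : ℝ) (x₀ : E3) (V : E3 → E3) (G : E3 → E3 →L[ℝ] E3),
    T₁ ≤ 0 ∧ T₁ ≤ T ∧ IsPastSelfSimilar ρ T T₁ x₀ u V ∧ ρ < 1 / 2 ∧
      Literature.Analysis.FunctionSpaces.HasWeakFDerivOn (⊤ : TopologicalSpace.Opens E3) volume V G ∧
      Integrable (fun y => Literature.Analysis.FluidPDE.curlCLM (G y)) volume ∧ MemLp (fun y => Literature.Analysis.FluidPDE.curlCLM (G y)) 2 volume)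

/-- SHAPE-PRESERVING WITH AN `A`-FAST OR FINITE-ENERGY CLOCK (v36/v45; LEAD g10 `PastShape.…`, ns-ezl-w4 g2 p619909) — senses/credits: CENSUS-19832-vNN.md. -/
@[reducible] def IsShapeFastClock (ρ : ℝ) (u : ℝ → E3 → E3) : Prop :=
  (∃ (T₁ c' : ℝ) (V : E3 → E3), T₁ ≤ 0 ∧ c' < 0 ∧
      ∀ τ : ℝ, τ < T₁ → ∀ y : E3, u τ y = Real.exp (c' * τ) • V (Real.exp (-(c' * τ)) • y)) ∨
    (∃ (T₁ T₀ g : ℝ) (V : E3 → E3), T₁ ≤ 0 ∧ T₁ ≤ T₀ ∧ 1 / 2 - ρ / 5 < g ∧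
      ∀ τ : ℝ, τ < T₁ → ∀ y : E3, u τ y = (T₀ - τ) ^ (g - 1) • V ((T₀ - τ) ^ (-g) • y)) ∨
    (∃ (g : ℝ) (V : E3 → E3), g < 1 / (2 + ρ) ∧
      ∀ τ : ℝ, τ < 0 → ∀ y : E3, u τ y = (-τ) ^ (g - 1) • V ((-τ) ^ (-g) • y)) ∨
    (∃ (T₁ T₀ g : ℝ) (V : E3 → E3), T₁ ≤ 0 ∧ T₁ ≤ T₀ ∧ g < 2 / 5 ∧
      (∀ τ : ℝ, τ < T₁ → ∀ y : E3, u τ y = (T₀ - τ) ^ (g - 1) • V ((T₀ - τ) ^ (-g) • y)) ∧ ∫⁻ z, ‖V z‖ₑ ^ 2 < ⊤) ∨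
    (ρ = 1 / 2 ∧ ∃ (T₁ T₀ g : ℝ) (V : E3 → E3), T₁ ≤ 0 ∧ T₁ ≤ T₀ ∧ g ≠ 2 / 5 ∧
      ∀ τ : ℝ, τ < T₁ → ∀ y : E3, u τ y = (T₀ - τ) ^ (g - 1) • V ((T₀ - τ) ^ (-g) • y))

/-- The member is a CLASSICAL AXISYMMETRIC SWIRL-FREE flow with SUB-PARABOLIC DRIFT (NEW in v37; line `swirlfree-ledger`, ns-idea-11 g0, verbatim its `IsSwirlFreeDrifting`) — senses/credits: CENSUS-19832-vNN.md. -/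
@[reducible] def IsSwirlFreeDrifting (u : ℝ → E3 → E3) (p : ℝ → E3 → ℝ) : Prop :=
  Literature.Analysis.FluidPDE.IsClassicalEulerSolutionOn (Set.Iio 0) 0 u p ∧
    (∀ τ : ℝ, τ < 0 → Literature.Analysis.FluidPDE.IsAxisymmetric (u τ) ∧ Literature.Analysis.FluidPDE.HasNoSwirl (u τ)) ∧
    ∃ M κ : ℝ, 1 / 2 < κ ∧ ∀ τ : ℝ, τ < 0 → ∀ x : E3, ‖u τ x‖ ≤ M * (-τ) ^ (-κ)

/-- Drift data `(M, κ)` of a classical axisymmetric swirl-free member (line `casimir-floor`, ns-idea-11 g3, VERBATIM its `IsSwirlFreeDriftingWith`). -/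
@[reducible] def IsSwirlFreeDriftingWith (u : ℝ → E3 → E3) (p : ℝ → E3 → ℝ) (M κ : ℝ) : Prop :=
  Literature.Analysis.FluidPDE.IsClassicalEulerSolutionOn (Set.Iio 0) 0 u p ∧
    (∀ τ : ℝ, τ < 0 → Literature.Analysis.FluidPDE.IsAxisymmetric (u τ) ∧ Literature.Analysis.FluidPDE.HasNoSwirl (u τ)) ∧
    0 ≤ M ∧ κ < 1 ∧ ∀ τ : ℝ, τ < 0 → ∀ x : E3, ‖u τ x‖ ≤ M * (-τ) ^ (-κ)

/-- CLASSICAL MIRROR-OUTGOING member (v49; line `mirror-moment` of ns-idea-11 g3) — senses/credits: CENSUS-19832-vNN.md. -/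
@[reducible] def IsMirrorOutgoing (ρ : ℝ) (u : ℝ → E3 → E3) (p : ℝ → E3 → ℝ) : Prop :=
  ∃ R₀ β : ℝ, β < 1 / (2 - ρ) ∧
    (Literature.Analysis.FluidPDE.IsClassicalEulerSolutionOn (Set.Iio 0) 0 u p ∧
      (∀ τ : ℝ, τ < 0 → Literature.Analysis.FluidPDE.IsAxisymmetric (u τ) ∧ Literature.Analysis.FluidPDE.HasNoSwirl (u τ)) ∧
      (∀ τ : ℝ, τ < 0 → ∀ x : E3, u τ (x - (2 * x 2) • (Literature.Analysis.FluidPDE.eZ : E3)) = u τ x - (2 * u τ x 2) • (Literature.Analysis.FluidPDE.eZ : E3)) ∧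
      (∀ τ : ℝ, τ < 0 → ∀ x : E3, 0 ≤ x 2 * Literature.Analysis.FluidPDE.swirl (Literature.Analysis.FluidPDE.curl (u τ)) x) ∧
      0 ≤ R₀ ∧ 0 ≤ β ∧
      (∀ τ : ℝ, τ < 0 → ∀ x : E3, R₀ * (1 + -τ) ^ β < Literature.Analysis.FluidPDE.cylRadius x → Literature.Analysis.FluidPDE.curl (u τ) x = 0) ∧
      (∀ τ : ℝ, τ < 0 →
        MeasureTheory.Integrable (fun x : E3 => (1 + ‖x‖) * ‖u τ x‖ ^ 2) ∧
          MeasureTheory.Integrable (fun x : E3 => (1 + ‖x‖) * (‖Literature.Analysis.FluidPDE.curl (u τ) x‖ / Literature.Analysis.FluidPDE.cylRadius x))) ∧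
      (∀ T T' : ℝ, T ≤ T' → T' < 0 → ∃ B : ℝ, ∀ τ ∈ Set.Icc T T', ∀ x : E3, ‖u τ x‖ ≤ B))

/-- SLAB-BOUNDED AXISYMMETRIC SWIRL-FREE flow (ρ-free, ENVELOPE-free; line `casimir_haul` of ns-idea-11 g10/g11, its `IsSlabBoundedSwirlFree` VERBATIM): classical Euler on the open past,
every slice axisymmetric and swirl-free, velocity bounded on every compact past time-slab. ⊇ `IsSwirlFreeDrifting`, `IsSwirlFreeDriftingWith _ _ M κ`, `IsMirrorOutgoing ρ`. -/
@[reducible] def IsSlabBoundedSwirlFree (u : ℝ → E3 → E3) (p : ℝ → E3 → ℝ) : Prop :=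
  Literature.Analysis.FluidPDE.IsClassicalEulerSolutionOn (Set.Iio 0) 0 u p ∧
    (∀ τ : ℝ, τ < 0 → Literature.Analysis.FluidPDE.IsAxisymmetric (u τ) ∧ Literature.Analysis.FluidPDE.HasNoSwirl (u τ)) ∧
    (∀ T₁ T₀ : ℝ, T₁ ≤ T₀ → T₀ < 0 → ∃ B : ℝ, ∀ τ ∈ Set.Icc T₁ T₀, ∀ x : E3, ‖u τ x‖ ≤ B)

/-- CLASSICAL AXISYMMETRIC SWIRL-FREE flow with SLOW SUB-LINEAR DRIFT `κ ∈ ((1−ρ)/(2−ρ), 1)` (v41; line `casimir-floor` of ns-idea-11 g3; fillers ns-cas-k2 g0 K1–K3: the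
sup-Casimir enstrophy floor; credits: CENSUS files). -/
@[reducible] def IsSwirlFreeSlowDrifting (ρ : ℝ) (u : ℝ → E3 → E3) (p : ℝ → E3 → ℝ) : Prop :=
  ∃ M κ : ℝ, (1 - ρ) / (2 - ρ) < κ ∧ IsSwirlFreeDriftingWith u p M κ

/-- CLASSICAL AXISYMMETRIC flow (swirl allowed) with SLOW SUB-LINEAR DRIFT `‖u(τ,x)‖ ≤ M(−τ)^{−κ}`, `κ ∈ ((1−ρ)/(2−ρ), 1)` (v44; lines `swirl-capacity` / `casimir-floor`;
filler ns-cas-k2 g0 `AxisymSlowDrifting.ae_eq_zero_of_gauge_of_axisymSlowDrifting'`; credits: CENSUS files). -/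
@[reducible] def IsAxisymSlowDrifting (ρ : ℝ) (u : ℝ → E3 → E3) (p : ℝ → E3 → ℝ) : Prop :=
  Literature.Analysis.FluidPDE.IsClassicalEulerSolutionOn (Set.Iio 0) 0 u p ∧
    (∀ τ : ℝ, τ < 0 → Literature.Analysis.FluidPDE.IsAxisymmetric (u τ) ∧ Literature.Analysis.FluidPDE.IsAxisymmetricScalar (p τ)) ∧
    ∃ M κ : ℝ, 0 ≤ M ∧ (1 - ρ) / (2 - ρ) < κ ∧ κ < 1 ∧ ∀ τ : ℝ, τ < 0 → ∀ x : E3, ‖u τ x‖ ≤ M * (-τ) ^ (-κ)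

/-- LOG-TIME BREATHER `u(τ,y) = e^{cτ} V(e^{−cτ} y)`, `c ≠ 0`, in one of two killed senses (credits v44–v72: CENSUS files; line `logtime-breathers` T3): CLASSICAL on the slab
(ns-ezl-w4 g2 p628444), OR WEAK below ANY `T₁ ≤ 0` with ANY profile and no regularity (ns-ezl-w4 g3 p645360). -/
@[reducible] def IsTameBreather (ρ : ℝ) (u : ℝ → E3 → E3) (p : ℝ → E3 → ℝ) : Prop :=
  (Literature.Analysis.FluidPDE.IsClassicalEulerSolutionOn (Set.Iio 0) 0 u p ∧
      ∃ (c : ℝ) (V : E3 → E3), c ≠ 0 ∧ ∀ τ : ℝ, τ < 0 → ∀ y : E3, u τ y = Real.exp (c * τ) • V (Real.exp (-(c * τ)) • y)) ∨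
    (0 < ρ ∧ ∃ (T₁ c : ℝ) (V : E3 → E3), T₁ ≤ 0 ∧ c ≠ 0 ∧
      ∀ τ : ℝ, τ < T₁ → ∀ y : E3, u τ y = Real.exp (c * τ) • V (Real.exp (-(c * τ)) • y))

/-- The member is a DISCRETE BREATHER (NEW in v46; width seat ns-ezl-w4 g2 p620990 `…DiscreteBreather`, weak class): `u(τ,y) = Λ·u(τ − P₀, y/Λ)` for
`τ < T₁` with `P₀ > 0`, and EITHER expanding `0 < Λ < 1` (`T₁ ≤ 0`), OR contracting `Λ > 1` with a slice-energy bound `∫|u(τ)|² ≤ E₀` for `τ` in some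
interval `(α, β)`, `β ≤ T₁`, OR `ρ = ½` and any `Λ ≠ 1` (`T₁ ≤ 0`). -/
@[reducible] def IsDiscreteBreather (ρ : ℝ) (u : ℝ → E3 → E3) : Prop :=
  (∃ T₁ P₀ Λ : ℝ, T₁ ≤ 0 ∧ 0 < P₀ ∧ 0 < Λ ∧ Λ < 1 ∧ ∀ τ : ℝ, τ < T₁ → ∀ y : E3, u τ y = Λ • u (τ - P₀) (Λ⁻¹ • y)) ∨
    (∃ T₁ P₀ Λ α β E₀ : ℝ, 0 < P₀ ∧ 1 < Λ ∧ (∀ τ : ℝ, τ < T₁ → ∀ y : E3, u τ y = Λ • u (τ - P₀) (Λ⁻¹ • y)) ∧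
      α < β ∧ β ≤ T₁ ∧ ∀ τ : ℝ, τ ∈ Set.Ioo α β → ∫⁻ y, ‖u τ y‖ₑ ^ 2 ≤ ENNReal.ofReal E₀) ∨
    (ρ = 1 / 2 ∧ ∃ T₁ P₀ Λ : ℝ, T₁ ≤ 0 ∧ 0 < P₀ ∧ 0 < Λ ∧ Λ ≠ 1 ∧ ∀ τ : ℝ, τ < T₁ → ∀ y : E3, u τ y = Λ • u (τ - P₀) (Λ⁻¹ • y))

/-- DISCRETE CLOCK (v47; ns-ezl-w4 g2 `…DiscreteClock`, weak class, no profile) — senses/credits: CENSUS-19832-vNN.md. -/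
@[reducible] def IsDiscreteClock (ρ : ℝ) (u : ℝ → E3 → E3) : Prop :=
  ∃ T g : ℝ, 1 < T ∧ (∀ τ : ℝ, τ < 0 → ∀ y : E3, u τ y = T ^ (1 - g) • u (T * τ) (T ^ g • y)) ∧
    (1 / 2 - ρ / 5 < g ∨ g < 1 / (2 + ρ) ∨
      (g < 2 / 5 ∧ ∃ α β E₀ : ℝ, α < β ∧ β < 0 ∧ ∀ τ : ℝ, τ ∈ Set.Ioo α β → ∫⁻ y, ‖u τ y‖ₑ ^ 2 ≤ ENNReal.ofReal E₀) ∨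
      (ρ = 1 / 2 ∧ g ≠ 2 / 5))

/-- EXACTLY SELF-SIMILAR ABOUT THE ORIGIN AT AN OFF-CLASS RATE (v48/v58 velocity-only; ns-ezl-w4 g2 p623579 `…SelfSimilarOffRate`, weak class, ANY profile) — senses/credits: CENSUS-19832-vNN.md. -/
@[reducible] def IsOffRateSelfSimilar (ρ : ℝ) (u : ℝ → E3 → E3) : Prop :=
  (∃ (g : ℝ) (W : E3 → E3), g ≠ 1 / (2 + ρ) ∧
    (∀ τ : ℝ, τ < 0 → u τ = Literature.Analysis.FluidPDE.selfSimilarCollapse g 0 W τ)) ∨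
  (∃ (T T₁ : ℝ) (x₀ : E3) (g : ℝ) (W : E3 → E3), T₁ ≤ 0 ∧ T₁ ≤ T ∧
    (g < 2 / 5 ∨ (1 / (2 + ρ) < g ∧ g < 1 / 2) ∨
      (0 < g ∧ 2 * g ≤ 1 ∧ ∀ ε : ℝ, 0 < ε → ∀ L₀ : ℝ, ∃ L : ℝ, L₀ ≤ L ∧
        L ^ (2 / g - 5) * ∫ y in Metric.ball (0 : E3) L, ‖W y‖ ^ 2 < ε)) ∧
    (∀ τ : ℝ, τ < T₁ → u τ = fun x => Literature.Analysis.FluidPDE.selfSimilarCollapse g T W τ (x - x₀)))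

/-- The velocity profile has BOUNDED VORTICAL BERNOULLI LEVELS AND AN UNPRESSURISED VORTICAL FAR FIELD — senses/credits: CENSUS-19832-vNN.md. -/
@[reducible] def HasVorticalBernoulliBound (ρ : ℝ) (V : E3 → E3) : Prop :=
  ∀ P' : E3 → ℝ, Literature.Analysis.FluidPDE.IsSelfSimilarEulerProfile (1 / (2 + ρ)) 0 V P' →
    (∃ Mb : ℝ, ∀ y : E3, Literature.Analysis.FluidPDE.curl V y ≠ 0 →
        Literature.Analysis.FluidPDE.selfSimilarBernoulli (1 / (2 + ρ)) 0 V P' y ≤ Mb) ∧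
    (∃ ε R₀ : ℝ, ε < (1 / (2 + ρ)) * (1 - 1 / (2 + ρ)) / 2 ∧
        ∀ y : E3, R₀ ≤ ‖y‖ → Literature.Analysis.FluidPDE.curl V y ≠ 0 → P' y ≤ ε * ‖y‖ ^ 2)

/-- TAME VORTICAL BERNOULLI LEVELS — senses/credits: CENSUS-19832-vNN.md. -/
@[reducible] def HasTameVorticalBernoulli (ρ : ℝ) (V : E3 → E3) : Prop :=
  HasVorticalBernoulliBound ρ V ∨
    ((∀ P' : E3 → ℝ, Literature.Analysis.FluidPDE.IsSelfSimilarEulerProfile (1 / (2 + ρ)) 0 V P' →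
        ∃ Mb : ℝ, ∀ y : E3, Literature.Analysis.FluidPDE.curl V y ≠ 0 → Literature.Analysis.FluidPDE.selfSimilarBernoulli (1 / (2 + ρ)) 0 V P' y ≤ Mb) ∧
      (∃ A q R₀ : ℝ, 0 ≤ A ∧ 0 ≤ q ∧ q < 2 + 2 * (1 + 2 * ρ) / 3 ∧
        ∀ z : E3, R₀ ≤ ‖z‖ → Literature.Analysis.FluidPDE.frobeniusNormSq (fderiv ℝ V z) - ‖Literature.Analysis.FluidPDE.curl V z‖ ^ 2 ≤ A * ‖z‖ ^ q))

/-- PERSISTENT FAST CORE at a polynomial scale (v48; ns-ezl-w1 g2 p623999 `NeedleCorePersistence.…corePersistence`) — senses/credits: CENSUS-19832-vNN.md. -/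
@[reducible] def HasPersistentCore (ρ : ℝ) (V : E3 → E3) : Prop :=
  ∃ κ q K R₀ : ℝ, 0 < κ ∧ κ < 1 / (2 + ρ) ∧ q < 2 + ρ ∧ 0 < K ∧
    ∀ y : E3, R₀ ≤ ‖y‖ → inner ℝ y (V y) < -(κ * ‖y‖ ^ 2) →
      ∀ y' : E3, ‖y' - y‖ ≤ K * ‖y‖ ^ (1 - q) → inner ℝ y (V y') ≤ -(κ / 2 * ‖y‖ ^ 2)

/-- KINEMATICALLY TAME profile (the `c`-dependent Loc-only binder), fourteen killed senses (v111: + the two R53 FLOOR faces) — senses/credits: CENSUS-19832-vNN.md. -/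
@[reducible] def IsKinematicTameProfile (ρ : ℝ) (c : ℝ≥0) (V : E3 → E3) : Prop :=
  HasPersistentCore ρ V ∨
    (∃ K B σ : ℝ, 0 ≤ B ∧ 0 ≤ σ ∧ σ < 2 + ρ ∧ ∀ y : E3, ‖fderiv ℝ V y‖ ≤ K * Real.exp (B * (1 + ‖y‖) ^ σ)) ∨
    (∀ c' : ℝ, 0 < c' → ∀ R₀ : ℝ, ∃ R : ℝ, R₀ ≤ R ∧
      ∀ z ∈ Metric.ball (0 : E3) (3 * R), ‖fderiv ℝ V z‖ ≤ Real.exp (c' * R ^ (2 + ρ))) ∨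
    (∃ c' : ℝ, c' < Real.pi * (1 / (2 + ρ)) ^ 2 / (128 * (3 : ℝ) ^ (1 - ρ) * ((1 - ρ) / (2 + ρ) * (c : ℝ) + 1)) ∧
      ∀ R₀ : ℝ, ∃ R : ℝ, R₀ ≤ R ∧
        ∀ z ∈ Metric.ball (0 : E3) (3 * R), ‖fderiv ℝ V z‖ ≤ Real.exp (c' * R ^ (2 + ρ))) ∨
    (∃ C : ℝ, ∀ R₀ : ℝ, ∃ R : ℝ, R₀ ≤ R ∧
      ∀ z ∈ Metric.ball (0 : E3) (3 * R), ‖fderiv ℝ V z‖ ≤ Real.exp (C * R ^ (2 + ρ))) ∨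
    (∃ (q : ℝ) (ℓ G : ℕ → ℝ), 1 < q ∧ (∀ k : ℕ, 0 < ℓ k) ∧ (∀ k : ℕ, q * ℓ k ≤ ℓ (k + 1)) ∧ (∀ k : ℕ, 1 ≤ G k) ∧
      (∀ k : ℕ, ∀ z ∈ Metric.ball (0 : E3) (q * ℓ k), ‖fderiv ℝ V z‖ ≤ Real.exp (G k)) ∧
      ¬ Summable (fun k : ℕ => ℓ k ^ (2 + ρ) / G k)) ∨
    (∀ P' : E3 → ℝ, Literature.Analysis.FluidPDE.IsSelfSimilarEulerProfile (1 / (2 + ρ)) 0 V P' →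
      ∃ x₀ : E3, Literature.Analysis.FluidPDE.curl V x₀ ≠ 0 ∧ ∃ h : ℝ, h < Literature.Analysis.FluidPDE.selfSimilarBernoulli (1 / (2 + ρ)) 0 V P' x₀ ∧
        ∃ w₀ R₁ : ℝ, 0 < w₀ ∧ (∀ y : E3, R₁ ≤ ‖y‖ →
          h < Literature.Analysis.FluidPDE.selfSimilarBernoulli (1 / (2 + ρ)) 0 V P' y → Literature.Analysis.FluidPDE.curl V y ≠ 0 →
            w₀ ≤ ‖Literature.Analysis.FluidPDE.selfSimilarTransport (1 / (2 + ρ)) 0 V y‖) ∧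
        ∃ C : ℝ, C < (1 - 2 * (1 / (2 + ρ))) * w₀ ^ 2 * (min 1 ((1 / (2 + ρ)) ^ 2 / (614400 * (Theorems.PowerGaugeEulerLiouville.NeedleBandLaw.bandConst + 1) * (2 * ((c : ℝ) * 2 ^ (1 - 2 * ρ)) + 2 * ((1 - ρ) / (2 + ρ) * (c : ℝ)) + 2))) / 4) / (24 * (1 / (2 + ρ))) ∧
          ∀ R : ℝ, 1 ≤ R → ∀ z : E3, ‖z‖ ≤ 2 * R → Literature.Analysis.FluidPDE.curl V z ≠ 0 →
          h < Literature.Analysis.FluidPDE.selfSimilarBernoulli (1 / (2 + ρ)) 0 V P' z →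
            Literature.Analysis.FluidPDE.selfSimilarBernoulli (1 / (2 + ρ)) 0 V P' z ≤ h + C * R ^ (2 + ρ)) ∨
    Theorems.PowerGaugeEulerLiouville.HasStraightSlowHighRuns ρ c V ∨
    Theorems.PowerGaugeEulerLiouville.HasStraightSlowHighRunsFree ρ V ∨
    Theorems.PowerGaugeEulerLiouville.HasStraightSlowHighRunsBare ρ V ∨
    Theorems.PowerGaugeEulerLiouville.HasStraightRidgeRuns ρ V ∨
    Theorems.PowerGaugeEulerLiouville.HasFatFastCore ρ V ∨
    Theorems.PowerGaugeEulerLiouville.MomentFloor.HasLqVorticity ρ V ∨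
    Theorems.PowerGaugeEulerLiouville.MomentFloor.HasSubBorderlineVorticity ρ V

/-- BERNOULLI-CLOCKED CORE WITH IRROTATIONAL PIERCING (v54/v60; ns-cas-k2 g2 K-A″ p638084; the physical-variables Bernoulli lever for classical members): classical on `(−∞,0)`
with a continuous gradient majorant; a sub-Bernoulli pressure clock of rate `n ∈ [0,½)`, defect `θ < 1`; Type-I data on moving balls `‖x‖ ≤ R(−s)ⁿ`; a subcritical slow set;
irrotational piercing on moving spheres beyond every radius. -/
@[reducible] def IsBernoulliClockedCore (u : ℝ → E3 → E3) (p : ℝ → E3 → ℝ) : Prop :=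
  ∃ (Λ : ℝ → ℝ) (n θ : ℝ),
    Literature.Analysis.FluidPDE.IsClassicalEulerSolutionOn (Set.Iio 0) 0 u p ∧ ContinuousOn Λ (Set.Iio 0) ∧
    (∀ s : ℝ, s < 0 → ∀ y : E3, ‖fderiv ℝ (u s) y‖ ≤ Λ s) ∧ 0 ≤ n ∧ n < 1 / 2 ∧ θ < 1 ∧
    (∀ s : ℝ, s < 0 → ∀ x : E3,
      (-s) * Literature.Analysis.FluidPDE.timeDerivWithin (Set.Iio 0) p s x - n * fderiv ℝ (p s) x x - 2 * (1 - n) * p s x ≤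
        θ * (1 - 2 * n) * ‖u s x + (n / (-s)) • x‖ ^ 2) ∧
    (∀ R : ℝ, 0 < R → ∃ A P₀ G Cω ε κ : ℝ, 0 < ε ∧ κ < 1 ∧
      (∀ s : ℝ, s < 0 → ∀ x : E3, ‖x‖ ≤ R * (-s) ^ n →
        (-s) ^ (1 - n) * ‖u s x‖ ≤ A ∧ (-s) ^ (2 - 2 * n) * p s x ≤ P₀ ∧ (-s) ^ (2 - n) * ‖gradient (p s) x‖ ≤ G ∧
          (-s) * ‖Literature.Analysis.FluidPDE.curl (u s) x‖ ≤ Cω ∧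
          ((-s) ^ (1 - n) * ‖u s x + (n / (-s)) • x‖ < ε →
            inner ℝ (fderiv ℝ (u s) x (Literature.Analysis.FluidPDE.curl (u s) x)) (Literature.Analysis.FluidPDE.curl (u s) x) ≤
              κ / (-s) * ‖Literature.Analysis.FluidPDE.curl (u s) x‖ ^ 2))) ∧
    (∀ R₀ : ℝ, ∃ R : ℝ, R₀ ≤ R ∧ ∀ σ : ℝ, σ < 0 → ∀ x : E3, ‖x‖ = R * (-σ) ^ n →
      inner ℝ x (u σ x) ≤ -(n * ‖x‖ ^ 2 / (-σ)) → Literature.Analysis.FluidPDE.curl (u σ) x = 0)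

end Summit.NavierStokesRegularity.NavierStokesRegularity.Theorems.PowerGaugeEulerLiouville.Birth

end
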